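import Mathlib
import Literature.Probability.LatticeModels.LatticeGraph
import HarnessLib

/-!
# The `4 × 4` discrete torus is the `4`-cube

The nearest-neighbour graph of the two-dimensional torus `(ℤ/4ℤ)²` (`torusGraph 2 4`) is isomorphic
to the hypercube graph `Q₄` on `{0,1}⁴` (two bit strings are adjacent iff they differ in exactly one
bit): the `4`-cycle is the `2`-cube under the Gray code `0 ↦ 00, 1 ↦ 01, 2 ↦ 11, 3 ↦ 10`, and the
Cartesian square of the `2`-cube is the `4`-cube. Consequently the automorphism group of
`torusGraph 2 4` is the hyperoctahedral group of order `2⁴ · 4! = 384`, three times larger than the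
`128` maps generated by translations, the coordinate swap and the inversions; the extra symmetries
(e.g. the bit transposition exchanging `(1,1)` and `(2,0)`) are invisible on larger tori. This is the
standard "hidden symmetry of the `4 × 4` lattice" of exact-diagonalisation practice.

Contents (all elementary, kernel-decided on the `16` sites):
* `TorusFour.gray` / `TorusFour.ungray` / `TorusFour.grayEquiv` — the Gray coding
  `(ℤ/4ℤ)² ≃ (Fin 4 → Bool)`;
* `TorusFour.adj_iff_hammingDist_eq_one` — `x ∼ y` in `torusGraph 2 4` iff the Gray images are at
  Hamming distance `1`;
* `TorusFour.hypercubeAut s` — the graph automorphism of `torusGraph 2 4` induced by a permutation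
  `s` of the four bits (`hypercubeAut_adj`), fixing the origin (`hypercubeAut_zero`);
* `TorusFour.grayWeight`, `TorusFour.weightRep`, `TorusFour.permFor`,
  `TorusFour.hypercubeAut_permFor` — every site is the image of the representative
  `0, (1,0), (1,1), (2,1), (2,2)` of its Gray weight (`=` graph distance from `0`) under an explicit
  bit permutation: the stabiliser of `0` acts transitively on every sphere (`Q₄` is distance
  transitive).

Sources: W. Imrich, S. Klavžar, *Product Graphs* (Wiley 2000), §1.4 (hypercubes as Cartesian powers of
`K₂`, `C₄ = K₂ □ K₂`); A. E. Brouwer, W. H. Haemers, *Spectra of Graphs* (2012) §12.4.1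
(the `n`-cube is distance transitive with automorphism group `2ⁿ·Sₙ`). Not here: the full
automorphism group as a `Subgroup`, tori of other sizes (the phenomenon is special to side `4`).
-/

namespace Literature.Probability.LatticeModels

namespace TorusFour

/-- High Gray bit of `z ∈ ℤ/4ℤ`: `0, 1 ↦ false`, `2, 3 ↦ true`. [folklore] -/
def hiBit (z : ZMod 4) : Bool := decide (2 ≤ z.val)

/-- Low Gray bit of `z ∈ ℤ/4ℤ`: `0, 3 ↦ false`, `1, 2 ↦ true`. [folklore] -/
def loBit (z : ZMod 4) : Bool := decide (z.val = 1 ∨ z.val = 2)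

/-- Gray decoding of a bit pair: `00 ↦ 0, 01 ↦ 1, 11 ↦ 2, 10 ↦ 3`. [folklore] -/
def ungrayZ : Bool → Bool → ZMod 4
  | false, false => 0
  | false, true => 1
  | true, true => 2
  | true, false => 3

/-- The Gray coding of a site of the `4 × 4` torus as a string of four bits
(`x₀ ↦` bits `0,1`, `x₁ ↦` bits `2,3`). [folklore] -/
def gray (x : TorusSite 2 4) : Fin 4 → Bool :=
  ![hiBit (x 0), loBit (x 0), hiBit (x 1), loBit (x 1)]

/-- The inverse Gray coding `(Fin 4 → Bool) → (ℤ/4ℤ)²`. [folklore] -/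
def ungray (u : Fin 4 → Bool) : TorusSite 2 4 :=
  ![ungrayZ (u 0) (u 1), ungrayZ (u 2) (u 3)]

/-- Decoding after coding one coordinate. [folklore] -/
theorem ungrayZ_hiBit_loBit : ∀ z : ZMod 4, ungrayZ (hiBit z) (loBit z) = z := by decide

/-- Coding after decoding, high bit. [folklore] -/
theorem hiBit_ungrayZ : ∀ a b : Bool, hiBit (ungrayZ a b) = a := by decide

/-- Coding after decoding, low bit. [folklore] -/
theorem loBit_ungrayZ : ∀ a b : Bool, loBit (ungrayZ a b) = b := by decide

/-- Every site of the `4 × 4` torus is the vector of its two coordinates. [folklore] -/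
theorem eq_vec (x : TorusSite 2 4) : x = ![x 0, x 1] := by
  funext i
  fin_cases i <;> rfl

/-- `ungray ∘ gray = id`. [folklore] -/
theorem ungray_gray (x : TorusSite 2 4) : ungray (gray x) = x := by
  rw [eq_vec x]
  funext i
  fin_cases i <;> simp [gray, ungray, ungrayZ_hiBit_loBit]

/-- `gray ∘ ungray = id`. [folklore] -/
theorem gray_ungray (u : Fin 4 → Bool) : gray (ungray u) = u := by
  funext i
  fin_cases i <;> simp [gray, ungray, hiBit_ungrayZ, loBit_ungrayZ]

/-- The Gray coding as an equivalence `(ℤ/4ℤ)² ≃ (Fin 4 → Bool)`. [folklore] -/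
def grayEquiv : TorusSite 2 4 ≃ (Fin 4 → Bool) :=
  ⟨gray, ungray, ungray_gray, gray_ungray⟩

/-- **The `4 × 4` torus is the `4`-cube**, coordinate form: `![a,b] ∼ ![c,d]` in `torusGraph 2 4`
iff the Gray images differ in exactly one bit. Decided on the `256` pairs.
[cite: ImrichKlavzar2000, §1.4] -/
theorem adj_vec_iff_hammingDist_eq_one :
    ∀ a b c d : ZMod 4, (torusGraph 2 4).Adj ![a, b] ![c, d] ↔
      hammingDist (gray ![a, b]) (gray ![c, d]) = 1 := by
  decide

/-- **The `4 × 4` torus is the `4`-cube**: `x ∼ y` in `torusGraph 2 4` iff the Gray images of `x`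
and `y` are at Hamming distance `1`. [cite: ImrichKlavzar2000, §1.4] -/
theorem adj_iff_hammingDist_eq_one (x y : TorusSite 2 4) :
    (torusGraph 2 4).Adj x y ↔ hammingDist (gray x) (gray y) = 1 := by
  rw [eq_vec x, eq_vec y]
  exact adj_vec_iff_hammingDist_eq_one _ _ _ _

/-- Reindexing both strings along a permutation of the positions preserves the Hamming distance.
[folklore] -/
theorem hammingDist_comp_perm {ι β : Type*} [Fintype ι] [DecidableEq β] (u v : ι → β)
    (e : Equiv.Perm ι) : hammingDist (u ∘ e) (v ∘ e) = hammingDist u v := by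
  unfold hammingDist
  refine Finset.card_bij (fun i _ => e i) (fun i hi => by simpa using hi)
    (fun i _ j _ h => e.injective h) (fun j hj => ⟨e.symm j, by simpa using hj, by simp⟩)

/-- The automorphism of the `4 × 4` torus induced by a permutation `s` of the four Gray bits
(bit `j` is moved to position `s j`): `x ↦ ungray (gray x ∘ s⁻¹)`. [cite: BrouwerHaemers2012, §12.4.1] -/
def hypercubeAut (s : Equiv.Perm (Fin 4)) : TorusSite 2 4 ≃ TorusSite 2 4 :=
  grayEquiv.trans ((Equiv.arrowCongr s (Equiv.refl Bool)).trans grayEquiv.symm)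

/-- Pointwise formula for `hypercubeAut`. [folklore] -/
theorem hypercubeAut_apply (s : Equiv.Perm (Fin 4)) (x : TorusSite 2 4) :
    hypercubeAut s x = ungray (gray x ∘ s.symm) := rfl

/-- The Gray image of `hypercubeAut s x` is the reindexed Gray image of `x`. [folklore] -/
theorem gray_hypercubeAut (s : Equiv.Perm (Fin 4)) (x : TorusSite 2 4) :
    gray (hypercubeAut s x) = gray x ∘ s.symm := by
  rw [hypercubeAut_apply, gray_ungray]

/-- **Bit permutations are graph automorphisms of the `4 × 4` torus.**
[cite: BrouwerHaemers2012, §12.4.1] -/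
theorem hypercubeAut_adj (s : Equiv.Perm (Fin 4)) (x y : TorusSite 2 4) :
    (torusGraph 2 4).Adj (hypercubeAut s x) (hypercubeAut s y) ↔ (torusGraph 2 4).Adj x y := by
  rw [adj_iff_hammingDist_eq_one, adj_iff_hammingDist_eq_one, gray_hypercubeAut, gray_hypercubeAut,
    hammingDist_comp_perm]

/-- The Gray image of the origin is the zero string. [folklore] -/
theorem gray_zero : gray 0 = fun _ => false := by
  funext i
  fin_cases i <;> rfl

/-- Bit permutations fix the origin. [folklore] -/
theorem hypercubeAut_zero (s : Equiv.Perm (Fin 4)) : hypercubeAut s 0 = 0 := by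
  rw [hypercubeAut_apply, gray_zero]
  show ungray (fun _ => false) = 0
  funext i
  fin_cases i <;> rfl

/-- The Gray weight of a site: the number of `true` bits of its Gray image, i.e. its graph distance
from the origin in `torusGraph 2 4 ≅ Q₄`. [folklore] -/
def grayWeight (x : TorusSite 2 4) : ℕ := (Finset.univ.filter fun i => gray x i = true).card

/-- Representatives of the five Gray-weight spheres: `0`, `(1,0)`, `(1,1)`, `(2,1)`, `(2,2)`.
[folklore] -/
def weightRep : ℕ → TorusSite 2 4
  | 1 => ![1, 0]
  | 2 => ![1, 1]
  | 3 => ![2, 1]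
  | 4 => ![2, 2]
  | _ => 0

/-- For each site `(a, b)`, a permutation of the four bits carrying the representative of its
Gray-weight sphere to it (a table of products of transpositions). [folklore] -/
def permTab : Fin 4 → Fin 4 → Equiv.Perm (Fin 4) :=
  ![![1, Equiv.swap 1 3 * Equiv.swap 2 3, Equiv.swap 1 2, Equiv.swap 1 2],
    ![1, 1, Equiv.swap 0 1 * Equiv.swap 1 2, Equiv.swap 2 3],
    ![Equiv.swap 0 2 * Equiv.swap 1 2 * Equiv.swap 2 3, 1, 1, Equiv.swap 2 3],
    ![Equiv.swap 0 1, Equiv.swap 0 1, Equiv.swap 1 2, Equiv.swap 0 1 * Equiv.swap 2 3]]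

/-- The bit permutation attached to a site (`permTab` at its two coordinates). [folklore] -/
def permFor (x : TorusSite 2 4) : Equiv.Perm (Fin 4) := permTab (x 0) (x 1)

/-- The Gray weight is at most `4`, coordinate form. [folklore] -/
theorem grayWeight_vec_le : ∀ a b : ZMod 4, grayWeight ![a, b] ≤ 4 := by decide

/-- The Gray weight is at most `4`. [folklore] -/
theorem grayWeight_le (x : TorusSite 2 4) : grayWeight x ≤ 4 := by
  rw [eq_vec x]; exact grayWeight_vec_le _ _

/-- **The stabiliser of the origin is transitive on spheres**, coordinate form: the tabulated bit
permutation carries the representative of the Gray weight of `![a, b]` to `![a, b]`. Decided on the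
`16` sites. [cite: BrouwerHaemers2012, §12.4.1] -/
theorem hypercubeAut_permTab_weightRep :
    ∀ a b : ZMod 4, hypercubeAut (permTab a b) (weightRep (grayWeight ![a, b])) = ![a, b] := by
  decide

/-- **The stabiliser of the origin is transitive on spheres**: every site `x` of the `4 × 4` torus is
the image of the representative `weightRep (grayWeight x)` under the graph automorphism
`hypercubeAut (permFor x)` (which fixes `0`). [cite: BrouwerHaemers2012, §12.4.1] -/
theorem hypercubeAut_permFor (x : TorusSite 2 4) :
    hypercubeAut (permFor x) (weightRep (grayWeight x)) = x := by
  conv_rhs => rw [eq_vec x]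
  rw [permFor, eq_vec x]
  exact hypercubeAut_permTab_weightRep _ _

/-- The Gray weights of the sixteen sites, coordinate form (the table behind the radial book-keeping
of `4 × 4` kernels): weight `0` at `0`; `1` at `(±1,0),(0,±1)`; `2` at `(±1,±1),(2,0),(0,2)`; `3` at
`(2,±1),(±1,2)`; `4` at `(2,2)`. [folklore] -/
theorem grayWeight_table :
    grayWeight ![0, 0] = 0 ∧ grayWeight ![1, 0] = 1 ∧ grayWeight ![0, 1] = 1 ∧ grayWeight ![3, 0] = 1 ∧
    grayWeight ![0, 3] = 1 ∧ grayWeight ![1, 1] = 2 ∧ grayWeight ![1, 3] = 2 ∧ grayWeight ![3, 1] = 2 ∧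
    grayWeight ![3, 3] = 2 ∧ grayWeight ![2, 0] = 2 ∧ grayWeight ![0, 2] = 2 ∧ grayWeight ![2, 1] = 3 ∧
    grayWeight ![2, 3] = 3 ∧ grayWeight ![1, 2] = 3 ∧ grayWeight ![3, 2] = 3 ∧ grayWeight ![2, 2] = 4 := by
  decide

end TorusFour

end Literature.Probability.LatticeModels
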